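import Summits.QuantumFields.YangMills.Theorems.IR.SCFloorTorusCovariance
import Literature.MathematicalPhysics.QuantumFieldTheory.UniformTorusClusteringProofs
import Mathlib.Analysis.Analytic.Order

/-!
# Strong-coupling floor engine, part 10: the volume-uniform `b⁴` law by the Schwarz lemma

Pooled prover `ym-ir-line-bsf-p1` (crux `IR`, stmt-QuantumFields-19354; director-ym R366 pooled queue).  The facing-plaquette
covariance `Cov_L(β)` of the torus Wilson state `(ℤ/L)⁴` (parts 2–9) is, as a function of COMPLEX `β`, a truncated
expectation of the torus plaquette system: holomorphic on the strong-coupling disc `‖β‖ < β_R` with a bound `K` UNIFORM IN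
THE VOLUME (tree: Osterwalder–Seiler machinery, `PlaqSystem.norm_truncatedExpect_le_const`).  Part 9 gives, on each torus,
`Cov_L(b) − J b⁴ = O_L(b⁵)` on the real axis with the VOLUME-INDEPENDENT coefficient `J = φ^{*6}(1)`; for a holomorphic
function that forces analytic order `≥ 5` at `0` (`isBigO_pow_of_real_bound`), and the Schwarz lemma with multiplicity
(tree `norm_le_of_isBigO_pow`) turns the uniform disc bound into the uniform estimate
`|Cov_L(b) − J b⁴| ≤ K' (b/r)⁵` for `0 ≤ b ≤ r`, all `L ≥ 3` (`cov_facing_schwarz`).  Nothing here bears on the Yang–Mills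
mass gap (Clay); strong coupling only.
-/

set_option autoImplicit false

noncomputable section

open MeasureTheory Filter Topology Function Finset Asymptotics
open Literature.MathematicalPhysics.QuantumFieldTheory
open Literature.MathematicalPhysics.QuantumLattice (haarConv plaquetteObs torusLift toTorusObservable LGConfig
  plaquetteHolonomyZd)

namespace Summit.QuantumFields.YangMills.Cruxes.IR.SCFloor

/-! ## §1 Analytic order from a real-axis bound -/

/-- **Order of vanishing read off the real axis.**  If `h` is analytic at `0` and `‖h t‖ ≤ K t^n` for small real
`t > 0`, then `h = O(z^n)` at `0`. -/
theorem isBigO_pow_of_real_bound {h : ℂ → ℂ} (hh : AnalyticAt ℂ h 0) {n : ℕ} {K b₁ : ℝ} (hb₁ : 0 < b₁)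
    (hreal : ∀ t : ℝ, 0 < t → t ≤ b₁ → ‖h t‖ ≤ K * t ^ n) : h =O[𝓝 (0 : ℂ)] fun z => z ^ n := by
  -- it suffices that the analytic order is at least `n`
  suffices hn : (n : ℕ∞) ≤ analyticOrderAt h 0 by
    obtain ⟨g, hg, hfg⟩ := (natCast_le_analyticOrderAt hh).1 hn
    have hgb : ∀ᶠ z in 𝓝 (0 : ℂ), ‖g z‖ ≤ ‖g 0‖ + 1 := by
      have := hg.continuousAt.norm.eventually (ge_mem_nhds (lt_add_one ‖g 0‖))
      exact this
    refine IsBigO.of_bound (‖g 0‖ + 1) ?_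
    filter_upwards [hfg, hgb] with z hz hgz
    rw [hz, sub_zero, norm_smul, norm_pow, mul_comm]
    exact mul_le_mul_of_nonneg_right hgz (by positivity)
  by_contra hlt
  push Not at hlt
  have hne : analyticOrderAt h 0 ≠ ⊤ := ne_top_of_lt hlt
  obtain ⟨g, hg, hg0, hfg⟩ := hh.analyticOrderAt_ne_top.1 hne
  set m := analyticOrderNatAt h 0 with hm
  have hmn : m < n := by
    have h1 : (m : ℕ∞) = analyticOrderAt h 0 := Nat.cast_analyticOrderNatAt hne
    rw [← h1] at hlt
    exact_mod_cast hlt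
  -- along the positive real axis `‖g t‖ ≤ K t^{n-m} → 0`
  have hof : Tendsto (fun t : ℝ => (t : ℂ)) (𝓝[>] 0) (𝓝 0) := by
    have : Tendsto (fun t : ℝ => (t : ℂ)) (𝓝 0) (𝓝 ((0 : ℝ) : ℂ)) := Complex.continuous_ofReal.tendsto 0
    simpa using this.mono_left nhdsWithin_le_nhds
  have hev : ∀ᶠ t : ℝ in 𝓝[>] 0, ‖g (t : ℂ)‖ ≤ K * t ^ (n - m) := by
    have h1 : ∀ᶠ t : ℝ in 𝓝[>] 0, h (t : ℂ) = ((t : ℂ) - 0) ^ m • g (t : ℂ) := hof.eventually hfg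
    have h2 : ∀ᶠ t : ℝ in 𝓝[>] 0, 0 < t ∧ t ≤ b₁ := by
      filter_upwards [self_mem_nhdsWithin, nhdsWithin_le_nhds (Iic_mem_nhds hb₁)] with t ht ht'
      exact ⟨ht, ht'⟩
    filter_upwards [h1, h2] with t h1 ⟨ht0, ht1⟩
    have hb := hreal t ht0 ht1
    rw [h1, sub_zero, norm_smul, norm_pow, Complex.norm_real, Real.norm_eq_abs, abs_of_pos ht0] at hb
    have htm : 0 < t ^ m := pow_pos ht0 m
    rw [show K * t ^ n = t ^ m * (K * t ^ (n - m)) by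
      rw [mul_left_comm, ← pow_add, Nat.add_sub_of_le hmn.le]] at hb
    exact le_of_mul_le_mul_left hb htm
  have hlim1 : Tendsto (fun t : ℝ => ‖g (t : ℂ)‖) (𝓝[>] 0) (𝓝 ‖g 0‖) :=
    (hg.continuousAt.norm.tendsto).comp hof
  have hlim2 : Tendsto (fun t : ℝ => K * t ^ (n - m)) (𝓝[>] 0) (𝓝 0) := by
    have hk : n - m ≠ 0 := by omega
    have : Tendsto (fun t : ℝ => K * t ^ (n - m)) (𝓝 0) (𝓝 (K * 0 ^ (n - m))) :=
      (continuous_const.mul (continuous_pow _)).tendsto 0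
    rw [zero_pow hk, mul_zero] at this
    exact this.mono_left nhdsWithin_le_nhds
  have hle : ‖g 0‖ ≤ 0 := le_of_tendsto_of_tendsto hlim1 hlim2 hev
  exact hg0 (norm_le_zero_iff.1 hle)

/-! ## §2 The plaquette observables on `ℤ⁴` and on the torus -/

variable {L : ℕ} [NeZero L] {G : Type} [Group G] [TopologicalSpace G] [IsTopologicalGroup G]
  [CompactSpace G] [MeasurableSpace G] [BorelSpace G] {N : ℕ} (ρ : G →* Matrix (Fin N) (Fin N) ℂ)

omit [NeZero L] [TopologicalSpace G] [IsTopologicalGroup G] [CompactSpace G] [MeasurableSpace G] [BorelSpace G] in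
/-- The `ℤ⁴` plaquette observable restricted to the torus is the torus plaquette observable at the projected site. -/
theorem toTorusObservable_plaquetteObs_eq (x : Literature.Probability.LatticeModels.Site 4) (i j : Fin 4) :
    toTorusObservable L (plaquetteObs ρ x i j) = fun U : GaugeConfig 4 L G =>
      (ρ (plaquetteHolonomy U (Literature.Probability.LatticeModels.Torus.proj L x) i j)).trace.re := by
  funext U
  simp only [toTorusObservable, Function.comp_apply, plaquetteObs, plaquetteHolonomyZd, plaquetteHolonomy, torusLift,
    Literature.MathematicalPhysics.QuantumLattice.torusEdge, torusProj_site_add_single]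

/-! ## §3 The volume-uniform Schwarz estimate -/

variable [SecondCountableTopology G] [T2Space G]

/-- **The facing-plaquette covariance obeys the `b⁴` law UNIFORMLY IN THE VOLUME.**  There are `K'` and `r > 0`
(depending only on `ρ`) such that on every torus `(ℤ/L)⁴`, `L ≥ 3`, and for every `0 ≤ b ≤ r`:
`|Cov_{wilsonMeasure ρ b}(Re tr ρ(U_{P₀}), Re tr ρ(U_{P₁})) − φ^{*6}(1) · b⁴| ≤ K' (b/r)⁵`,
`φ = Re tr ρ − ∫ Re tr ρ`.  (Holomorphy + volume-uniform disc bound from the Osterwalder–Seiler machinery, order `≥ 5`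
at `0` from the torus expansion of part 9, Schwarz lemma with multiplicity.) -/
theorem cov_facing_schwarz (hρ : Continuous ρ) :
    ∃ K' r : ℝ, 0 < r ∧ ∀ (L : ℕ) [NeZero L], 3 ≤ L → ∀ b : ℝ, 0 ≤ b → b ≤ r →
      |((∫ U, (ρ (plaquetteHolonomy U 0 1 2)).trace.re * (ρ (plaquetteHolonomy U ((0 : Site 4 L).shift 0) 1 2)).trace.re
            ∂(wilsonMeasure (d := 4) (L := L) ρ b)) -
          (∫ U, (ρ (plaquetteHolonomy U 0 1 2)).trace.re ∂(wilsonMeasure (d := 4) (L := L) ρ b)) *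
            ∫ U, (ρ (plaquetteHolonomy U ((0 : Site 4 L).shift 0) 1 2)).trace.re
              ∂(wilsonMeasure (d := 4) (L := L) ρ b)) -
        ((haarConv (fun g => (ρ g).trace.re - ∫ h, (ρ h).trace.re ∂haarProbability G))^[5]
          (fun g => (ρ g).trace.re - ∫ h, (ρ h).trace.re ∂haarProbability G)) 1 * b ^ 4| ≤ K' * (b / r) ^ 5 := by
  classical
  set J : ℝ := ((haarConv (fun g => (ρ g).trace.re - ∫ h, (ρ h).trace.re ∂haarProbability G))^[5]
    (fun g => (ρ g).trace.re - ∫ h, (ρ h).trace.re ∂haarProbability G)) 1 with hJ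
  -- uniform bounds on the observables
  obtain ⟨Ctr, hCtr0, hCtr⟩ := exists_bound_trace_re_nonneg (ρ := ρ) hρ
  -- the disc radius and the constants (uniform in `L`)
  set R : ℝ := betaOne 4 ρ with hRdef
  have hR0 : 0 < R := betaOne_pos 4 (ρ := ρ)
  set r : ℝ := R / 2 with hrdef
  have hr : 0 < r := by positivity
  have hrR : r < R := by rw [hrdef]; linarith
  set κ : ℝ := 2 * Real.exp (1 / 2) with hκ
  have hκ1 : 1 ≤ κ := by
    rw [hκ]; have := Real.one_lt_exp_iff.2 (by norm_num : (0 : ℝ) < 1 / 2); linarith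
  set sB : ℕ := 8 * (2 ^ 4 * (4 * 4)) with hsB
  set Kc : ℝ := Ctr * Ctr * κ ^ sB + Ctr * κ ^ sB * (Ctr * κ ^ sB) + |J| * R ^ 4 with hKc
  refine ⟨Kc, r, hr, fun L _ hL b hb0 hbr => ?_⟩
  haveI : Fact (1 < L) := ⟨by omega⟩
  -- part 9 on this torus (real axis)
  obtain ⟨K, b₁, hb₁, htorus⟩ := torus_cov_facing_estimate (L := L) ρ hρ hL
  -- the observables of `ℤ⁴` and their periodic/twisted versions
  set x₀ : Literature.Probability.LatticeModels.Site 4 := 0 with hx₀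
  set x₁ : Literature.Probability.LatticeModels.Site 4 := Pi.single 0 1 with hx₁
  set F₁ : LGConfig 4 G → ℝ := plaquetteObs ρ x₀ 1 2 with hF₁
  set F₂ : LGConfig 4 G → ℝ := plaquetteObs ρ x₁ 1 2 with hF₂
  have hF₁m : Measurable F₁ := measurable_trace_re_plaquette ρ hρ x₀ 1 2
  have hF₂m : Measurable F₂ := measurable_trace_re_plaquette ρ hρ x₁ 1 2
  have hF₁b : ∀ U, |F₁ U| ≤ Ctr := fun U => by simp only [hF₁]; exact hCtr _
  have hF₂b : ∀ U, |F₂ U| ≤ Ctr := fun U => by simp only [hF₂]; exact hCtr _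
  have hF12m : Measurable fun U => F₁ U * F₂ U := hF₁m.mul hF₂m
  have hF12b : ∀ U, |F₁ U * F₂ U| ≤ Ctr * Ctr := fun U => by
    rw [abs_mul]; exact mul_le_mul (hF₁b U) (hF₂b U) (abs_nonneg _) hCtr0
  -- torus observables are the plaquette traces of the statement
  have hp0 : (Literature.Probability.LatticeModels.Torus.proj L x₀ : Site 4 L) = 0 := by
    funext k; simp [hx₀, Literature.Probability.LatticeModels.Torus.proj_apply]
  have hp1 : (Literature.Probability.LatticeModels.Torus.proj L x₁ : Site 4 L) = (0 : Site 4 L).shift 0 := by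
    rw [hx₁, torusProj_site_single]; simp [Site.shift]
  have hT₁ : toTorusObservable L F₁ = fun U : GaugeConfig 4 L G => (ρ (plaquetteHolonomy U 0 1 2)).trace.re := by
    rw [hF₁, toTorusObservable_plaquetteObs_eq, hp0]
  have hT₂ : toTorusObservable L F₂ = fun U : GaugeConfig 4 L G =>
      (ρ (plaquetteHolonomy U ((0 : Site 4 L).shift 0) 1 2)).trace.re := by
    rw [hF₂, toTorusObservable_plaquetteObs_eq, hp1]
  have hT₁₂ : toTorusObservable L (fun U => F₁ U * F₂ U) = fun U : GaugeConfig 4 L G =>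
      (ρ (plaquetteHolonomy U 0 1 2)).trace.re * (ρ (plaquetteHolonomy U ((0 : Site 4 L).shift 0) 1 2)).trace.re := by
    funext U
    have h1 := congrFun hT₁ U
    have h2 := congrFun hT₂ U
    simp only [toTorusObservable, Function.comp_apply] at h1 h2 ⊢
    rw [h1, h2]
  -- the complex truncated expectation
  set S := torusSystem (d := 4) (G := G) ρ L with hSdef
  have hReg : S.Regular (costBound ρ) (Plaq.degBound 4) := torusSystem_regular ρ hρ
  set V := torusGenuine 4 L with hV
  set Φ₁ : ZdGaugeConfig 4 G → ℂ := fun U => (F₁ (U ∘ torusRed L) : ℂ) with hΦ₁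
  set Φ₂ : ZdGaugeConfig 4 G → ℂ := fun U => (F₂ (U ∘ torusRed L) : ℂ) with hΦ₂
  have hΦ₁m : Measurable Φ₁ := Complex.measurable_ofReal.comp (hF₁m.comp (measurable_comp_relabel (torusRed L)))
  have hΦ₂m : Measurable Φ₂ := Complex.measurable_ofReal.comp (hF₂m.comp (measurable_comp_relabel (torusRed L)))
  have hΦ₁b : ∀ U, ‖Φ₁ U‖ ≤ Ctr := fun U => by rw [hΦ₁, Complex.norm_real, Real.norm_eq_abs]; exact hF₁b _
  have hΦ₂b : ∀ U, ‖Φ₂ U‖ ≤ Ctr := fun U => by rw [hΦ₂, Complex.norm_real, Real.norm_eq_abs]; exact hF₂b _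
  have h12d : ((1 : Fin 4), (2 : Fin 4)).1 < ((1 : Fin 4), (2 : Fin 4)).2 := by decide
  set P0z : Literature.MathematicalPhysics.QuantumLattice.ZdPlaquette 4 := (x₀, ⟨((1 : Fin 4), (2 : Fin 4)), h12d⟩) with hP0z
  set P1z : Literature.MathematicalPhysics.QuantumLattice.ZdPlaquette 4 := (x₁, ⟨((1 : Fin 4), (2 : Fin 4)), h12d⟩) with hP1z
  set B₁ : Finset (ZdEdge 4) := Literature.MathematicalPhysics.QuantumLattice.plaquetteEdges P0z with hB₁
  set B₂ : Finset (ZdEdge 4) := Literature.MathematicalPhysics.QuantumLattice.plaquetteEdges P1z with hB₂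
  have hF₁d : DependsOn F₁ (B₁ : Set (ZdEdge 4)) :=
    Literature.MathematicalPhysics.QuantumLattice.isCylinder_plaquetteObs (G := G) ρ P0z
  have hF₂d : DependsOn F₂ (B₂ : Set (ZdEdge 4)) :=
    Literature.MathematicalPhysics.QuantumLattice.isCylinder_plaquetteObs (G := G) ρ P1z
  have hΦ₁d : DependsOn Φ₁ ((B₁.image (torusRed L) : Finset (ZdEdge 4)) : Set (ZdEdge 4)) :=
    dependsOn_comp_torusRed L (F := fun U => (F₁ U : ℂ)) fun U W h => by
      show (F₁ U : ℂ) = F₁ W; rw [hF₁d h]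
  have hΦ₂d : DependsOn Φ₂ ((B₂.image (torusRed L) : Finset (ZdEdge 4)) : Set (ZdEdge 4)) :=
    dependsOn_comp_torusRed L (F := fun U => (F₂ U : ℂ)) fun U W h => by
      show (F₂ U : ℂ) = F₂ W; rw [hF₂d h]
  -- seed counts, uniformly in `L`
  have hB₁c : B₁.card ≤ 4 := Finset.card_le_four
  have hB₂c : B₂.card ≤ 4 := Finset.card_le_four
  have hs₁ : (S.seedsOf (B₁.image (torusRed L))).card ≤ sB := by
    refine (card_seedsOf_torusSystem_le ρ B₁).trans ((card_seedsOf_le_mul B₁).trans ?_)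
    rw [hsB]; exact Nat.mul_le_mul_right _ (by omega)
  have hs₂ : (S.seedsOf (B₂.image (torusRed L))).card ≤ sB := by
    refine (card_seedsOf_torusSystem_le ρ B₂).trans ((card_seedsOf_le_mul B₂).trans ?_)
    rw [hsB]; exact Nat.mul_le_mul_right _ (by omega)
  have hs₁₂ : (S.seedsOf (B₁.image (torusRed L) ∪ B₂.image (torusRed L))).card ≤ sB := by
    rw [← Finset.image_union]
    refine (card_seedsOf_torusSystem_le ρ _).trans ((card_seedsOf_le_mul _).trans ?_)
    rw [hsB]
    exact Nat.mul_le_mul_right _ ((Finset.card_union_le _ _).trans (by omega))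
  -- the holomorphic function `G(β) = ⟨Φ₁Φ₂⟩ − ⟨Φ₁⟩⟨Φ₂⟩ − J β⁴`
  set Gf : ℂ → ℂ := fun β => S.expect (fun U => Φ₁ U * Φ₂ U) V β - S.expect Φ₁ V β * S.expect Φ₂ V β - (J : ℂ) * β ^ 4
    with hGf
  have h12 : ∀ U, ‖Φ₁ U * Φ₂ U‖ ≤ Ctr * Ctr := fun U => by
    rw [norm_mul]; exact mul_le_mul (hΦ₁b U) (hΦ₂b U) (norm_nonneg _) hCtr0
  have hdiff : DifferentiableOn ℂ Gf (Metric.ball 0 (PlaqSystem.betaR (costBound ρ) (Plaq.degBound 4))) :=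
    (((PlaqSystem.differentiableOn_expect hReg (hΦ₁m.mul hΦ₂m) h12 V).sub
      ((PlaqSystem.differentiableOn_expect hReg hΦ₁m hΦ₁b V).mul
        (PlaqSystem.differentiableOn_expect hReg hΦ₂m hΦ₂b V))).sub
      ((differentiable_const _).mul (differentiable_id.pow 4)).differentiableOn)
  have hRβ : PlaqSystem.betaR (costBound ρ) (Plaq.degBound 4) = R := by rw [hRdef, betaR_costBound]
  have hbound : ∀ z ∈ Metric.ball (0 : ℂ) (PlaqSystem.betaR (costBound ρ) (Plaq.degBound 4)), ‖Gf z‖ ≤ Kc := by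
    intro z hz
    have hz' : ‖z‖ ≤ PlaqSystem.betaR (costBound ρ) (Plaq.degBound 4) := le_of_lt (mem_ball_zero_iff.1 hz)
    have htr := PlaqSystem.norm_truncatedExpect_le_const hReg hz' hΦ₁m hΦ₂m hΦ₁b hΦ₂b hΦ₁d hΦ₂d V
    have hzR : ‖z‖ ≤ R := by rwa [hRβ] at hz'
    calc ‖Gf z‖ ≤ ‖S.expect (fun U => Φ₁ U * Φ₂ U) V z - S.expect Φ₁ V z * S.expect Φ₂ V z‖ + ‖(J : ℂ) * z ^ 4‖ :=
          norm_sub_le _ _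
      _ ≤ (Ctr * Ctr * κ ^ sB + Ctr * κ ^ sB * (Ctr * κ ^ sB)) + |J| * R ^ 4 := by
          refine add_le_add (htr.trans ?_) ?_
          · refine add_le_add (mul_le_mul_of_nonneg_left (pow_le_pow_right₀ hκ1 hs₁₂) (by positivity))
              (mul_le_mul (mul_le_mul_of_nonneg_left (pow_le_pow_right₀ hκ1 hs₁) hCtr0)
                (mul_le_mul_of_nonneg_left (pow_le_pow_right₀ hκ1 hs₂) hCtr0) (by positivity) (by positivity))
          · rw [norm_mul, Complex.norm_real, Real.norm_eq_abs, norm_pow]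
            exact mul_le_mul_of_nonneg_left (pow_le_pow_left₀ (norm_nonneg _) hzR 4) (abs_nonneg _)
      _ = Kc := by rw [hKc]
  -- on the real axis `Gf t` is the real covariance minus `J t⁴`
  have hreal_eq : ∀ t : ℝ, Gf t =
      ((((∫ U, (ρ (plaquetteHolonomy U 0 1 2)).trace.re * (ρ (plaquetteHolonomy U ((0 : Site 4 L).shift 0) 1 2)).trace.re
            ∂(wilsonMeasure (d := 4) (L := L) ρ t)) -
          (∫ U, (ρ (plaquetteHolonomy U 0 1 2)).trace.re ∂(wilsonMeasure (d := 4) (L := L) ρ t)) *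
            ∫ U, (ρ (plaquetteHolonomy U ((0 : Site 4 L).shift 0) 1 2)).trace.re
              ∂(wilsonMeasure (d := 4) (L := L) ρ t)) - J * t ^ 4 : ℝ) : ℂ) := by
    intro t
    have e12 := wilsonExpectation_toTorusObservable_eq_re_expect (L := L) ρ hρ t hF12m hF12b
    have e1 := wilsonExpectation_toTorusObservable_eq_re_expect (L := L) ρ hρ t hF₁m hF₁b
    have e2 := wilsonExpectation_toTorusObservable_eq_re_expect (L := L) ρ hρ t hF₂m hF₂b
    rw [hT₁₂] at e12; rw [hT₁] at e1; rw [hT₂] at e2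
    simp only [wilsonExpectation] at e12 e1 e2
    have i12 := PlaqSystem.expect_ofReal_im (S := S) (fun U => F₁ (U ∘ torusRed L) * F₂ (U ∘ torusRed L)) V t
    have i1 := PlaqSystem.expect_ofReal_im (S := S) (fun U => F₁ (U ∘ torusRed L)) V t
    have i2 := PlaqSystem.expect_ofReal_im (S := S) (fun U => F₂ (U ∘ torusRed L)) V t
    have c1 : S.expect Φ₁ V t =
        ((∫ U, (ρ (plaquetteHolonomy U 0 1 2)).trace.re ∂(wilsonMeasure (d := 4) (L := L) ρ t) : ℝ) : ℂ) :=
      Complex.ext (by rw [Complex.ofReal_re]; exact e1.symm) (by rw [Complex.ofReal_im]; exact i1)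
    have c2 : S.expect Φ₂ V t =
        ((∫ U, (ρ (plaquetteHolonomy U ((0 : Site 4 L).shift 0) 1 2)).trace.re
          ∂(wilsonMeasure (d := 4) (L := L) ρ t) : ℝ) : ℂ) :=
      Complex.ext (by rw [Complex.ofReal_re]; exact e2.symm) (by rw [Complex.ofReal_im]; exact i2)
    have hprod : (fun U : ZdGaugeConfig 4 G => Φ₁ U * Φ₂ U) =
        fun U => (((F₁ (U ∘ torusRed L) * F₂ (U ∘ torusRed L)) : ℝ) : ℂ) := by
      funext U; simp only [hΦ₁, hΦ₂]; push_cast; ring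
    have c12 : S.expect (fun U => Φ₁ U * Φ₂ U) V t =
        ((∫ U, (ρ (plaquetteHolonomy U 0 1 2)).trace.re * (ρ (plaquetteHolonomy U ((0 : Site 4 L).shift 0) 1 2)).trace.re
          ∂(wilsonMeasure (d := 4) (L := L) ρ t) : ℝ) : ℂ) := by
      rw [hprod]
      exact Complex.ext (by rw [Complex.ofReal_re]; exact e12.symm) (by rw [Complex.ofReal_im]; exact i12)
    simp only [hGf]
    rw [c12, c1, c2]
    push_cast
    ring
  have hreal : ∀ t : ℝ, 0 < t → t ≤ b₁ → ‖Gf t‖ ≤ K * t ^ 5 := by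
    intro t ht0 ht1
    rw [hreal_eq t, Complex.norm_real, Real.norm_eq_abs]
    have := htorus t (by rw [abs_of_pos ht0]; exact ht1)
    rwa [abs_of_pos ht0] at this
  -- Schwarz lemma with multiplicity
  have hana : AnalyticAt ℂ Gf 0 :=
    (hdiff.analyticOnNhd (Metric.isOpen_ball)) 0 (Metric.mem_ball_self (by rw [hRβ]; exact hR0))
  have hO := isBigO_pow_of_real_bound hana hb₁ hreal
  have hSchwarz := norm_le_of_isBigO_pow hdiff hbound hO hr (by rw [hRβ]; exact hrR)
    (z := (b : ℂ)) (by rw [Complex.norm_real, Real.norm_eq_abs, abs_of_nonneg hb0]; exact hbr)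
  rw [hreal_eq b, Complex.norm_real, Real.norm_eq_abs, Complex.norm_real, Real.norm_eq_abs, abs_of_nonneg hb0] at hSchwarz
  exact hSchwarz

end Summit.QuantumFields.YangMills.Cruxes.IR.SCFloor

end
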